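import Literature.Probability.Percolation.Z2PivotalCampbellLimit
import Literature.Probability.Percolation.ScaledLatticeWalks
import Summits.CriticalPhenomena.CardyFormulaZ2.Theorems.CardyMeckeFlipFlipErgodicityZ2StubLatticeSecondMomentEdgeArm

/-!
# Crux `FlipErgodicityZ2` (stmt-CriticalPhenomena-14825), line `registered`, stub
# `stub_latticeSecondMoment`: reduction of the second moment to pair probabilities

Route `Summits/CriticalPhenomena/CardyFormulaZ2/Theses/CardyMeckeFlip`.  Helper file (supports the
crux item).  The uniform second-moment bound of the isometry-averaged Garban–Pete–Schramm pivotal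
measures `μ^ε_δ(ω) = z2PivotalMeasure ε δ ω = Σ_e w_e(ω) δ_{mid e}` of bond-`ℤ²` asks for
`sup_{δ ≤ δ₀} E[(∫ |φ| dμ^ε_δ)²] < ∞`.  This file performs the model-free first step of the
classical computation (Garban–Pete–Schramm, JAMS 26 (2013), §4.3–4.4: "`E[X²] ≍ η⁻⁴ α₄^η(η,1)²`
… these well-known second moment calculations"): it bounds the second moment by the
normalisation `r(δ)²` times a double sum of PAIR PROBABILITIES of lattice four-arm events,

  `E[(∫ |φ| dμ^ε_δ)²] ≤ (‖φ‖_∞ r(δ))² Σ_{e,e'} P(A_e ∩ A_{e'})`,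

where `A_e = edgeFourArm (x + [-m,m]²) x i` is the cluster-form event "four alternating arms from
the edge `e = s(x, x + eᵢ)` to the boundary of the lattice box of radius `m ≍ ε/δ` around it"
and the sum ranges over the finitely many edges charged by `φ`.  Steps:

* `edgeFourArm_ball_of_gridImportant` — for EVERY moved `ε`-grid, an `ε`-important edge has four
  arms inside the block of lattice sites drawn within Euclidean distance `ε` of its midpoint
  (the `3ε`-block `Q̃` of the grid square containing the midpoint contains that disc; arms
  restrict to sub-blocks, `edgeFourArm_of_subset`); hence the averaged weight satisfies
  `w_e(ω) ≤ r(δ) · 1_{A_e}(ω)` on lattice configurations (`pivotalWeight_toReal_le_mul_indicator`,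
  with the disc block, and `edgeFourArm_ball_subset_shiftBox` to pass to the box `x + [-m,m]²`
  drawn inside the disc);
* `integral_abs_le_mul_sum`, `sq_integral_abs_le` — `∫ |φ| dμ^ε_δ(ω) ≤ ‖φ‖_∞ Σ_e w_e(ω)` and the
  expansion of the square into indicators of pair events;
* `integral_sq_le_sum_pairs_shiftBox` — integration against `P_{1/2}` (lattice configurations
  carry `P_{1/2}`).
-/

noncomputable section

open MeasureTheory Set Filter Metric
open Literature.Probability.Percolation Literature.Probability.Percolation.QuadCrossing
open Literature.Probability.LatticeModels
open scoped ENNReal Topology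

namespace Summit.CriticalPhenomena.CardyFormulaZ2.Theorems.CardyMeckeFlip

/-! ### `ε`-importance forces four arms inside the `ε`-disc around the midpoint -/

/-- **The lattice sites drawn within `ε` of `m` lie in the `3ε`-block of the grid square
containing `m`**, for every moved `ε`-grid. [folklore] -/
theorem meshVertices_closedBall_subset_gridBlock {ε : ℝ} (hε : 0 < ε) (θ : ℝ) (s : Bool) (a : ℂ)
    (δ : ℝ) (m : ℂ) :
    meshVertices (closedBall m ε) δ ⊆ gridBlock ε θ s a δ (gridIndex ε θ s a m) := by
  intro v hv
  rw [mem_meshVertices_iff, mem_closedBall, dist_eq_norm] at hv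
  have := mem_gridBlock_coupled_of_norm_le (ε := ε) hε θ s a m hv
  rwa [sub_self, add_zero] at this

/-- **An `ε`-important edge (for any moved `ε`-grid) has four arms inside the `ε`-disc block
around its midpoint** (`0 < δ ≤ ε`, lattice configuration). [folklore] -/
theorem edgeFourArm_ball_of_gridImportant {ε δ : ℝ} (hδ : 0 < δ) (hδε : δ ≤ ε) (θ : ℝ)
    (s : Bool) (a : ℂ) {ω : BondConfig (Site 2)} (hω : ω ⊆ (zdGraph 2).edgeSet) {x : Site 2}
    {i : Fin 2} (h : ω ∈ gridImportant ε θ s a δ x i) :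
    ω ∈ edgeFourArm (meshVertices (closedBall (edgeMidpoint δ x i) ε) δ) x i := by
  have hε : 0 < ε := hδ.trans_le hδε
  have hend := norm_endpoints_sub_edgeMidpoint_le hδ x i
  unfold gridImportant at h
  refine edgeFourArm_of_subset (meshVertices_closedBall_subset_gridBlock hε θ s a δ _) ?_ ?_ hω h
  · rw [mem_meshVertices_iff, mem_closedBall, dist_eq_norm]
    exact hend.1.trans hδε
  · rw [mem_meshVertices_iff, mem_closedBall, dist_eq_norm]
    exact hend.2.trans hδε

/-- Off the disc four-arm event the averaged weight vanishes (`0 < δ ≤ ε`, lattice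
configuration). [folklore] -/
theorem pivotalWeight_eq_zero_of_notMem {ε δ : ℝ} (hδ : 0 < δ) (hδε : δ ≤ ε)
    {ω : BondConfig (Site 2)} (hω : ω ⊆ (zdGraph 2).edgeSet) {x : Site 2} {i : Fin 2}
    (h : ω ∉ edgeFourArm (meshVertices (closedBall (edgeMidpoint δ x i) ε) δ) x i) :
    pivotalWeight ε δ ω x i = 0 := by
  have h0 : ∀ s : Bool,
      {q : ℝ × ℝ × ℝ | ω ∈ gridImportant ε q.1 s (gridShift q) δ x i} = ∅ := fun s => by
    ext q
    simp only [mem_setOf_eq, mem_empty_iff_false, iff_false]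
    exact fun hq => h (edgeFourArm_ball_of_gridImportant hδ hδε q.1 s (gridShift q) hω hq)
  simp only [pivotalWeight, h0, measure_empty, add_zero, ENNReal.zero_div, mul_zero]

/-- **`w_e(ω) ≤ r(δ) · 1_{A_e}(ω)`** with `A_e` the disc four-arm event (`0 < δ ≤ ε`, lattice
configuration): the averaged GPS weight of an edge is at most the rate, and vanishes unless the
edge has four arms inside the `ε`-disc around its midpoint. [folklore] -/
theorem pivotalWeight_toReal_le_mul_indicator {ε δ : ℝ} (hδ : 0 < δ) (hδε : δ ≤ ε)
    {ω : BondConfig (Site 2)} (hω : ω ⊆ (zdGraph 2).edgeSet) (x : Site 2) (i : Fin 2) :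
    (pivotalWeight ε δ ω x i).toReal ≤ pivotalRate δ *
      (edgeFourArm (meshVertices (closedBall (edgeMidpoint δ x i) ε) δ) x i).indicator 1 ω := by
  by_cases h : ω ∈ edgeFourArm (meshVertices (closedBall (edgeMidpoint δ x i) ε) δ) x i
  · rw [indicator_of_mem h, Pi.one_apply, mul_one]
    exact pivotalWeight_toReal_le ε δ ω x i
  · rw [pivotalWeight_eq_zero_of_notMem hδ hδε hω h, indicator_of_notMem h, mul_zero]
    simp

/-! ### From the disc block to the lattice box `x + [-m,m]²` -/

/-- **The box `x + [-m,m]²` is drawn inside the `ε`-disc around the midpoint of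
`s(x, x + eᵢ)`** as soon as `2δm + δ ≤ ε` (`δ > 0`). [folklore] -/
theorem shiftBox_subset_meshVertices_closedBall {ε δ : ℝ} (hδ : 0 < δ) {m : ℕ}
    (hm : 2 * δ * m + δ ≤ ε) (x : Site 2) (i : Fin 2) :
    ∀ u : Site 2, u - x ∈ box 2 m →
      u ∈ meshVertices (closedBall (edgeMidpoint δ x i) ε) δ := by
  intro u hu
  rw [mem_meshVertices_iff, mem_closedBall]
  have h1 : dist (meshPoint δ u) (meshPoint δ x) ≤ 2 * δ * m := by
    rw [dist_eq_norm]
    have hmesh : meshPoint δ u - meshPoint δ x = (δ : ℂ) * Site.toComplex (u - x) := by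
      rw [meshPoint, meshPoint, toComplex_sub, mul_sub]
    rw [hmesh, norm_mul, Complex.norm_real, Real.norm_eq_abs, abs_of_pos hδ]
    have hbox := mem_box.1 hu
    have h0 := hbox 0
    have h1 := hbox 1
    have hre : |(Site.toComplex (u - x)).re| ≤ m := by
      rw [Site.toComplex_re, Pi.sub_apply]
      rw [Pi.sub_apply] at h0
      have : |((u 0 - x 0 : ℤ) : ℝ)| ≤ m := by
        rw [← Int.cast_abs]; exact_mod_cast abs_le.2 h0
      simpa using this
    have him : |(Site.toComplex (u - x)).im| ≤ m := by
      rw [Site.toComplex_im, Pi.sub_apply]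
      rw [Pi.sub_apply] at h1
      have : |((u 1 - x 1 : ℤ) : ℝ)| ≤ m := by
        rw [← Int.cast_abs]; exact_mod_cast abs_le.2 h1
      simpa using this
    calc δ * ‖Site.toComplex (u - x)‖
        ≤ δ * (|(Site.toComplex (u - x)).re| + |(Site.toComplex (u - x)).im|) :=
          mul_le_mul_of_nonneg_left (Complex.norm_le_abs_re_add_abs_im _) hδ.le
      _ ≤ δ * (m + m) := by gcongr
      _ = 2 * δ * m := by ring
  calc dist (meshPoint δ u) (edgeMidpoint δ x i)
      ≤ dist (meshPoint δ u) (meshPoint δ x) + dist (meshPoint δ x) (edgeMidpoint δ x i) :=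
        dist_triangle _ _ _
    _ ≤ 2 * δ * m + δ := add_le_add h1 (dist_meshPoint_edgeMidpoint_le hδ x i)
    _ ≤ ε := hm

/-- **Four arms inside the `ε`-disc block give four arms inside the box `x + [-m,m]²`**
(`1 ≤ m`, `2δm + δ ≤ ε`, lattice configuration). [folklore] -/
theorem edgeFourArm_ball_subset_shiftBox {ε δ : ℝ} (hδ : 0 < δ) {m : ℕ} (hm1 : 1 ≤ m)
    (hm : 2 * δ * m + δ ≤ ε) (x : Site 2) (i : Fin 2) {ω : BondConfig (Site 2)}
    (hω : ω ⊆ (zdGraph 2).edgeSet)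
    (h : ω ∈ edgeFourArm (meshVertices (closedBall (edgeMidpoint δ x i) ε) δ) x i) :
    ω ∈ edgeFourArm {u : Site 2 | u - x ∈ box 2 m} x i := by
  refine edgeFourArm_of_subset (W' := {u : Site 2 | u - x ∈ box 2 m})
    (fun u hu => shiftBox_subset_meshVertices_closedBall hδ hm x i u hu) ?_ ?_ hω h
  · show x - x ∈ box 2 m
    simp
  · show x + Pi.single i 1 - x ∈ box 2 m
    rw [add_sub_cancel_left]
    exact single_mem_box hm1 i

/-- **`w_e(ω) ≤ r(δ) · 1{four arms from `e` to `∂(x + [-m,m]²)`}`** (`0 < δ`, `1 ≤ m`,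
`2δm + δ ≤ ε`, lattice configuration). [folklore] -/
theorem pivotalWeight_toReal_le_mul_indicator_shiftBox {ε δ : ℝ} (hδ : 0 < δ) {m : ℕ}
    (hm1 : 1 ≤ m) (hm : 2 * δ * m + δ ≤ ε) {ω : BondConfig (Site 2)}
    (hω : ω ⊆ (zdGraph 2).edgeSet) (x : Site 2) (i : Fin 2) :
    (pivotalWeight ε δ ω x i).toReal ≤
      pivotalRate δ * (edgeFourArm {u : Site 2 | u - x ∈ box 2 m} x i).indicator 1 ω := by
  have hδε : δ ≤ ε := by
    have : (0 : ℝ) ≤ 2 * δ * m := by positivity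
    linarith
  by_cases h : ω ∈ edgeFourArm (meshVertices (closedBall (edgeMidpoint δ x i) ε) δ) x i
  · have h' := edgeFourArm_ball_subset_shiftBox hδ hm1 hm x i hω h
    rw [indicator_of_mem h', Pi.one_apply, mul_one]
    exact pivotalWeight_toReal_le ε δ ω x i
  · rw [pivotalWeight_eq_zero_of_notMem hδ hδε hω h, ENNReal.toReal_zero]
    exact mul_nonneg (pivotalRate_nonneg δ) (indicator_nonneg (fun _ _ => zero_le_one) _)

/-! ### The second moment against pair events -/

/-- **`∫ |φ| dμ^ε_δ(ω) ≤ ‖φ‖_∞ Σ_{e ∈ E} w_e(ω)`** for any finite set `E` of edges containing those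
charged by `φ` and any bound `B` of `|φ|`. [folklore] -/
theorem integral_abs_le_mul_sum (ε : ℝ) {δ : ℝ} (hδ : 0 < δ) (ω : BondConfig (Site 2))
    {φ : ℂ → ℝ} (hφ : Continuous φ) (hφc : HasCompactSupport φ) {B : ℝ} (hB : ∀ z, |φ z| ≤ B)
    (E : Finset (Site 2 × Fin 2))
    (hE : ∀ p : Site 2 × Fin 2, φ (edgeMidpoint δ p.1 p.2) ≠ 0 → p ∈ E) :
    ∫ z, |φ z| ∂(z2PivotalMeasure ε δ ω) ≤ B * ∑ p ∈ E, (pivotalWeight ε δ ω p.1 p.2).toReal := by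
  have habs : Continuous fun z => |φ z| := continuous_abs.comp hφ
  have habsc : HasCompactSupport fun z => |φ z| := hφc.comp_left (g := fun t : ℝ => |t|) abs_zero
  have hE' : ∀ p : Site 2 × Fin 2, |φ (edgeMidpoint δ p.1 p.2)| ≠ 0 → p ∈ E := fun p hp =>
    hE p (abs_ne_zero.1 hp)
  rw [integral_z2PivotalMeasure_eq_sum ε hδ ω habs habsc E hE', Finset.mul_sum]
  refine Finset.sum_le_sum fun p _ => ?_
  rw [mul_comm B]
  exact mul_le_mul_of_nonneg_left (hB _) ENNReal.toReal_nonneg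

/-- **Pointwise expansion of the square**: on a lattice configuration,
`(∫ |φ| dμ^ε_δ(ω))² ≤ (‖φ‖_∞ r(δ))² Σ_{e,e' ∈ E} 1_{A_e ∩ A_{e'}}(ω)` with
`A_e = edgeFourArm (x + [-m,m]²) x i` (`0 < δ`, `1 ≤ m`, `2δm + δ ≤ ε`). [folklore] -/
theorem sq_integral_abs_le {ε δ : ℝ} (hδ : 0 < δ) {m : ℕ} (hm1 : 1 ≤ m)
    (hm : 2 * δ * m + δ ≤ ε) {ω : BondConfig (Site 2)} (hω : ω ⊆ (zdGraph 2).edgeSet)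
    {φ : ℂ → ℝ} (hφ : Continuous φ) (hφc : HasCompactSupport φ) {B : ℝ} (hB : ∀ z, |φ z| ≤ B)
    (E : Finset (Site 2 × Fin 2))
    (hE : ∀ p : Site 2 × Fin 2, φ (edgeMidpoint δ p.1 p.2) ≠ 0 → p ∈ E) :
    (∫ z, |φ z| ∂(z2PivotalMeasure ε δ ω)) ^ 2 ≤
      (B * pivotalRate δ) ^ 2 * ∑ p ∈ E, ∑ q ∈ E,
        (edgeFourArm {u : Site 2 | u - p.1 ∈ box 2 m} p.1 p.2 ∩
          edgeFourArm {u : Site 2 | u - q.1 ∈ box 2 m} q.1 q.2).indicator 1 ω := by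
  set A : Site 2 × Fin 2 → Set (BondConfig (Site 2)) := fun p =>
    edgeFourArm {u : Site 2 | u - p.1 ∈ box 2 m} p.1 p.2 with hA
  have h0 : 0 ≤ ∫ z, |φ z| ∂(z2PivotalMeasure ε δ ω) := integral_nonneg fun z => abs_nonneg _
  have hB0 : 0 ≤ B := (abs_nonneg _).trans (hB 0)
  have h1 : ∫ z, |φ z| ∂(z2PivotalMeasure ε δ ω) ≤
      B * pivotalRate δ * ∑ p ∈ E, (A p).indicator 1 ω := by
    refine (integral_abs_le_mul_sum ε hδ ω hφ hφc hB E hE).trans ?_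
    rw [mul_assoc]
    refine mul_le_mul_of_nonneg_left ?_ hB0
    rw [Finset.mul_sum]
    exact Finset.sum_le_sum fun (p : Site 2 × Fin 2) _ =>
      pivotalWeight_toReal_le_mul_indicator_shiftBox hδ hm1 hm hω p.1 p.2
  have hind : ∀ p q : Site 2 × Fin 2, (A p).indicator (1 : BondConfig (Site 2) → ℝ) ω *
      (A q).indicator 1 ω = (A p ∩ A q).indicator 1 ω := by
    intro p q
    by_cases hp : ω ∈ A p <;> by_cases hq : ω ∈ A q <;>
      simp [indicator_of_mem, indicator_of_notMem, hp, hq, mem_inter_iff]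
  calc (∫ z, |φ z| ∂(z2PivotalMeasure ε δ ω)) ^ 2
      ≤ (B * pivotalRate δ * ∑ p ∈ E, (A p).indicator 1 ω) ^ 2 := pow_le_pow_left₀ h0 h1 2
    _ = (B * pivotalRate δ) ^ 2 *
          ((∑ p ∈ E, (A p).indicator 1 ω) * ∑ q ∈ E, (A q).indicator 1 ω) := by ring
    _ = (B * pivotalRate δ) ^ 2 * ∑ p ∈ E, ∑ q ∈ E, (A p ∩ A q).indicator 1 ω := by
        rw [Finset.sum_mul_sum]
        simp only [hind]

/-- **Reduction of the second moment to pair probabilities** (the model-free first step of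
GPS's second-moment computation, JAMS 26 (2013), §4.3–4.4): for `0 < δ`, `1 ≤ m`,
`2δm + δ ≤ ε`, a test function `φ ∈ C_c(ℂ)` bounded by `B`, and a finite set `E` of edges
containing those charged by `φ`,
`E[(∫ |φ| dμ^ε_δ)²] ≤ (B r(δ))² Σ_{e, e' ∈ E} P_{1/2}(A_e ∩ A_{e'})`, `A_e` the event of four
alternating arms from `e = s(x, x + eᵢ)` to the boundary of `x + [-m,m]²`. [folklore] -/
theorem integral_sq_le_sum_pairs_shiftBox :
    ∀ (ε δ : ℝ) (m : ℕ), 0 < δ → 1 ≤ m → 2 * δ * m + δ ≤ ε →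
      ∀ φ : ℂ → ℝ, Continuous φ → HasCompactSupport φ → ∀ B : ℝ, (∀ z, |φ z| ≤ B) →
        ∀ E : Finset (Site 2 × Fin 2),
          (∀ p : Site 2 × Fin 2, φ (edgeMidpoint δ p.1 p.2) ≠ 0 → p ∈ E) →
            ∫ ω, (∫ x, |φ x| ∂(z2PivotalMeasure ε δ ω)) ^ 2 ∂(bondPercolation (zdGraph 2) half) ≤
              (B * pivotalRate δ) ^ 2 * ∑ p ∈ E, ∑ q ∈ E, (bondPercolation (zdGraph 2) half).real
                (edgeFourArm {u : Site 2 | u - p.1 ∈ box 2 m} p.1 p.2 ∩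
                  edgeFourArm {u : Site 2 | u - q.1 ∈ box 2 m} q.1 q.2) := by
  intro ε δ m hδ hm1 hm φ hφ hφc B hB E hE
  set P := bondPercolation (zdGraph 2) half with hP
  haveI : IsProbabilityMeasure P := by rw [hP]; unfold bondPercolation; infer_instance
  have hε : 0 < ε := by
    have : (0 : ℝ) ≤ 2 * δ * m := by positivity
    linarith
  set A : Site 2 × Fin 2 → Set (BondConfig (Site 2)) := fun p =>
    edgeFourArm {u : Site 2 | u - p.1 ∈ box 2 m} p.1 p.2 with hA
  have hmeas : ∀ p q : Site 2 × Fin 2, MeasurableSet (A p ∩ A q) := fun p q =>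
    (measurableSet_edgeFourArm (finite_shiftBox p.1 m) p.1 p.2).inter
      (measurableSet_edgeFourArm (finite_shiftBox q.1 m) q.1 q.2)
  have habs : Continuous fun z => |φ z| := continuous_abs.comp hφ
  have habsc : HasCompactSupport fun z => |φ z| := hφc.comp_left (g := fun t : ℝ => |t|) abs_zero
  have hint : ∀ p q : Site 2 × Fin 2, Integrable ((A p ∩ A q).indicator (1 : BondConfig (Site 2) → ℝ)) P :=
    fun p q => (integrable_const 1).indicator (hmeas p q)
  have hrhs : (B * pivotalRate δ) ^ 2 * ∑ p ∈ E, ∑ q ∈ E, P.real (A p ∩ A q) =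
      ∫ ω, (B * pivotalRate δ) ^ 2 * ∑ p ∈ E, ∑ q ∈ E, (A p ∩ A q).indicator 1 ω ∂P := by
    rw [integral_const_mul, integral_finsetSum _ fun p _ =>
      integrable_finsetSum _ fun q _ => hint p q]
    congr 1
    refine Finset.sum_congr rfl fun p _ => ?_
    rw [integral_finsetSum _ fun q _ => hint p q]
    refine Finset.sum_congr rfl fun q _ => ?_
    rw [integral_indicator_one (hmeas p q)]
  rw [hrhs]
  refine integral_mono_ae (integrable_sq_integral_z2PivotalMeasure hε hδ habs habsc) ?_ ?_
  · exact (integrable_finsetSum _ fun p _ =>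
      integrable_finsetSum _ fun q _ => hint p q).const_mul _
  · filter_upwards [ae_subset_edgeSet (zdGraph 2) half] with ω hω
    exact sq_integral_abs_le hδ hm1 hm hω hφ hφc hB E hE

end Summit.CriticalPhenomena.CardyFormulaZ2.Theorems.CardyMeckeFlip

end
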